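import Literature.AlgebraicGeometry.Resolution.DifferentialOperators
import Mathlib.RingTheory.Kaehler.Basic
import HarnessLib

/-!
# Differential operators through principal parts (EGA IV₄ Déf. 16.8.1, 16.8.2) versus the commutator criterion
# (EGA IV₄ Prop. 16.8.8) — ring level; the comparison as NAMED FACTS

Topic: `Literature/AlgebraicGeometry/Resolution`. Companion of `DifferentialOperators.lean`, which takes EGA IV₄
Prop. 16.8.8 (b) — «every commutator `[D, a]` is a differential operator of order `≤ n − 1`» — as the DEFINITION of
`IsDiffOpLE R n D` / `diffOp R A n` («We take (b) as the DEFINITION (it only mentions `R`-linear endomorphisms of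
`A`, no module of principal parts)»). This file types Grothendieck's ORIGINAL definition (Déf. 16.8.1: `D = u ∘ d^n`
with `u : P^n → 𝒪` linear for the LEFT structure of the module of principal parts `P^n`), in the affine / ring-level
form of EGA IV₄ (16.8.2), and records the two comparison statements as named facts (`def … : Prop`, D-0014):

* `principalPartsRing R A n` — `P^n_{A/R} = (A ⊗_R A)/I^{n+1}`, `I` the kernel of multiplication (Mathlib
  `KaehlerDifferential.ideal R A`), with its `A`-module structure through the FIRST (left) factor (Mathlib
  `Algebra.TensorProduct.leftAlgebra`), as (16.8.2) prescribes: «la structure de B-module de ((B ⊗_A B)/ℑ^{n+1}) ⊗_B M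
  provenant du premier facteur B»;
* `principalPartsD R A n : A → P^n`, `t ↦` class of `1 ⊗ t` — (16.8.2): «la première flèche est l'homomorphisme
  canonique t ↦ 1 ⊗ t» (the universal operator `d^n` of Déf. 16.8.1);
* `diffOpOfPrincipalParts R A n : (P^n →ₗ[A] A) →ₗ[A] (A →ₗ[R] A)`, `u ↦ u ∘ d^n` (Déf. 16.8.1 «tel que l'on ait
  D = u ∘ d^n»; `A`-linear for the left structures);
* `IsDiffOpPP R A n D` — `D` is a differential operator of order `≤ n` IN THE SENSE OF Déf. 16.8.1 / (16.8.2);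
* **`EGA4_Prop16_8_8`** (NAMED FACT) — Prop. 16.8.8 (a) ⇔ (b) for `ℱ = 𝒢 = 𝒪_X`, affine-locally: `IsDiffOpPP R A n D ↔
  IsDiffOpLE R n D`;
* **`EGA4_16_8_3_1`** (NAMED FACT) — (16.8.3.1): `u ↦ u ∘ d^n` is injective («les homomorphismes u ↦ u ∘ d^n sont des
  isomorphismes de groupes additifs Hom(P^n(ℱ), 𝒢) → Diff^n(ℱ, 𝒢), en vertu du fait que l'image de ℱ par d^n engendre
  P^n(ℱ) (16.7.6)»; surjectivity onto `Diff^n` in the sense of Déf. 16.8.1 is the definition of `IsDiffOpPP`).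

Why now: the statements-first typing of Hironaka's 2017 manuscript (campaign `res-hironaka`, LADDER-RESOLUTION) types
the manuscript's `Diff_Z^{(m)}` through principal parts (its Eq. (3)/(4), `Hironaka2017/S03DiffARNE/R021aPrincipalParts`,
`…/R022aDiffOperators`: `toOperator`, candidate `U08_1`) while every consumer uses the tree carrier `diffOp`; the
adjudication desk registered the comparison as FACT-LIST candidate F-12 and asked for this decl
(`Literature.AlgebraicGeometry.Resolution.EGA4_Prop16_8_8`). Nothing here depends on the manuscript.

Source read on the page: A. Grothendieck, J. Dieudonné, ÉGA IV₄, Publ. Math. IHÉS 32 (1967) — held as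
`paper:doi-10-1007-bf02732123` (page files `p00NN.txt` = printed page NN+1): Déf. (16.8.1) printed p.39 (p0038.txt
l.43–47); (16.8.2) p.40 (p0039.txt l.22–36); (16.8.3.1) and Prop. (16.8.4) p.41 (p0040.txt l.5–19); Prop. (16.8.8)
(a)(b)(c) p.42 (p0041.txt l.31–45), proof p.43 (p0042.txt). [EGAIV4]

Scope / TODO(general form): EGA states Déf. 16.8.1 and Prop. 16.8.8 for a morphism of preschemes `f : X → S` and two
`𝒪_X`-Modules `ℱ`, `𝒢` (`D : ℱ → 𝒢` `f⁻¹(𝒪_S)`-linear); here only `ℱ = 𝒢 = 𝒪_X` over an affine open mapping into an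
affine open of `S` (`A = Γ(V, 𝒪_S)`-algebra `B = Γ(U, 𝒪_X)`, renamed `R`, `A` below), which is the case the tree's
`IsDiffOpLE` speaks about. No proofs in this file; discharging `EGA4_Prop16_8_8_holds` / `EGA4_16_8_3_1_holds` is
ordinary commutative algebra (induction on `n` with `I^{n+1}`-adic filtration; `P^n` generated by `d^n(A)` as a left
`A`-module) and is left to a prover seat.
-/

noncomputable section

namespace Literature.AlgebraicGeometry.Resolution

open scoped TensorProduct

universe u v

section PrincipalParts

variable (R : Type u) [CommRing R] (A : Type v) [CommRing A] [Algebra R A]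

/-- **The module of principal parts of order `n`, `P^n_{A/R} = (A ⊗_R A)/I^{n+1}`** (EGA IV₄ (16.8.2):
«Γ(U, 𝒫^n_{X/S}) = (B ⊗_A B)/ℑ^{n+1}», `ℑ` the kernel of the multiplication `B ⊗_A B → B` = Mathlib
`KaehlerDifferential.ideal`), as a quotient ring, with the `A`-module structure through the FIRST factor `a ↦ a ⊗ 1`
(Mathlib `Algebra.TensorProduct.leftAlgebra`, then `Ideal.Quotient.algebra`) — (16.8.2): «la structure de B-module …
provenant du premier facteur B». [cite: EGAIV4, (16.8.2) p.40] -/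
abbrev principalPartsRing (n : ℕ) : Type v :=
  (A ⊗[R] A) ⧸ KaehlerDifferential.ideal R A ^ (n + 1)

/-- **The universal operator `d^n : A → P^n_{A/R}`, `t ↦` class of `1 ⊗ t`** (EGA IV₄ (16.8.2): «la première
flèche est l'homomorphisme canonique t ↦ 1 ⊗ t»; Déf. 16.8.1's `d^n_{X/S}`), an `R`-algebra map through the
SECOND factor (Mathlib `Algebra.TensorProduct.includeRight`, then the quotient map). [cite: EGAIV4, (16.8.2) p.40] -/
def principalPartsD (n : ℕ) : A →ₐ[R] principalPartsRing R A n :=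
  (Ideal.Quotient.mkₐ R (KaehlerDifferential.ideal R A ^ (n + 1))).comp Algebra.TensorProduct.includeRight

/-- **`u ↦ u ∘ d^n`** (EGA IV₄ Déf. 16.8.1: «il existe un homomorphisme de 𝒪_X-Modules u : 𝒫^n_{X/S}(ℱ) → 𝒢 (où
𝒫^n_{X/S}(ℱ) est muni de sa structure de 𝒪_X-Module à gauche (16.7.4)) tel que l'on ait D = u ∘ d^n»; the map
(16.8.3.1) `Hom_{𝒪_U}(𝒫^n(ℱ|U), 𝒢|U) → Diff^n(ℱ|U, 𝒢|U)`), for `ℱ = 𝒢 = 𝒪` at ring level: the `A`-linear map sending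
`u : P^n →ₗ[A] A` to the `R`-linear endomorphism `t ↦ u(d^n t)` of `A` (`A` acting on `A →ₗ[R] A` through the
values). [cite: EGAIV4, Déf. 16.8.1 p.39; (16.8.3.1) p.41] -/
def diffOpOfPrincipalParts (n : ℕ) : (principalPartsRing R A n →ₗ[A] A) →ₗ[A] (A →ₗ[R] A) where
  toFun u := u.restrictScalars R ∘ₗ (principalPartsD R A n).toLinearMap
  map_add' _ _ := LinearMap.ext fun _ => rfl
  map_smul' _ _ := LinearMap.ext fun _ => rfl

/-- **Differential operator of order `≤ n` in the sense of EGA IV₄ Déf. 16.8.1** (ring level, `ℱ = 𝒢 = 𝒪`; by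
(16.8.2) «la définition de D signifie que … le A-homomorphisme D : M → N se factorise en M → 𝒫^n ⊗_B M →^v N où
la première flèche est … t ↦ 1 ⊗ t et v est un B-homomorphisme»): the `R`-linear `D : A → A` factors as `u ∘ d^n`
with `u : P^n_{A/R} → A` linear for the left `A`-structure. Compare the tree's `IsDiffOpLE R n D`
(`DifferentialOperators.lean`), which is EGA IV₄ Prop. 16.8.8 (b) taken as a definition; the two are compared by
the named fact `EGA4_Prop16_8_8`. [cite: EGAIV4, Déf. 16.8.1 p.39; (16.8.2) p.40] -/
def IsDiffOpPP (n : ℕ) (D : A →ₗ[R] A) : Prop :=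
  ∃ u : principalPartsRing R A n →ₗ[A] A, D = diffOpOfPrincipalParts R A n u

end PrincipalParts

/-- NAMED FACT — **EGA IV₄, Prop. (16.8.8), (a) ⇔ (b)** (printed p.42: «Soient ℱ, 𝒢 deux 𝒪_X-Modules,
D : ℱ → 𝒢 un homomorphisme de f⁻¹(𝒪_S)-Modules, n un entier ≥ 0. Les conditions suivantes sont équivalentes :
a) D est un opérateur différentiel d'ordre ≤ n. b) Pour toute section a de 𝒪_X au-dessus d'un ouvert U,
l'homomorphisme D_a : ℱ|U → 𝒢|U tel que, pour toute section t de ℱ au-dessus d'un ouvert V ⊂ U, on ait (16.8.8.1)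
D_a(t) = D(at) − aD(t) est un opérateur différentiel d'ordre ≤ n − 1.» — with the convention p.40 «on convient que
tout opérateur différentiel d'ordre < 0 est nul»), in the ring-level case `ℱ = 𝒢 = 𝒪_X` over an affine open
(16.8.2): for every commutative ring `R`, commutative `R`-algebra `A`, `n ≥ 0` and `R`-linear `D : A → A`,
`D` is a differential operator of order `≤ n` in the sense of Déf. 16.8.1 (`IsDiffOpPP`, through principal parts)
iff it is one in the sense of (b), i.e. the tree's `IsDiffOpLE R n D` (all `(n+1)`-fold commutators with
multiplications vanish). Users take `(h : EGA4_Prop16_8_8)`. [cite: EGAIV4, Prop. 16.8.8 p.42]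
-- TODO(general form): arbitrary `𝒪_X`-Modules `ℱ`, `𝒢` over a morphism of preschemes `X → S`, and condition (c)
-- (16.8.8.2). -/
def EGA4_Prop16_8_8 : Prop :=
  ∀ (R : Type u) (A : Type v) [CommRing R] [CommRing A] [Algebra R A] (n : ℕ) (D : A →ₗ[R] A),
    IsDiffOpPP R A n D ↔ IsDiffOpLE R n D

/-- NAMED FACT — **EGA IV₄ (16.8.3.1)** (printed p.41: «pour U ouvert variable dans X, les homomorphismes
u ↦ u ∘ d^n_{X/S} sont des isomorphismes de groupes additifs (16.8.3.1) Hom_{𝒪_U}(𝒫^n_{X/S}(ℱ|U), 𝒢|U) →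
Diff^n_{U/S}(ℱ|U, 𝒢|U), en vertu du fait que l'image de ℱ par d^n_{X/S} engendre 𝒫^n_{X/S}(ℱ) (16.7.6)»), in the
ring-level case `ℱ = 𝒢 = 𝒪_X`: `u ↦ u ∘ d^n` (`diffOpOfPrincipalParts`) is INJECTIVE — a differential operator
determines its linear form on the principal parts (surjectivity onto the operators of Déf. 16.8.1 is the
definition of `IsDiffOpPP`). Users take `(h : EGA4_16_8_3_1)`. [cite: EGAIV4, (16.8.3.1) p.41]
-- TODO(general form): `𝒪_X`-Modules `ℱ`, `𝒢`; bijectivity as stated. -/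
def EGA4_16_8_3_1 : Prop :=
  ∀ (R : Type u) (A : Type v) [CommRing R] [CommRing A] [Algebra R A] (n : ℕ),
    Function.Injective (diffOpOfPrincipalParts R A n)

/-! ## Discharge (appended 2026-08-26, res-hironaka res-lit-3): `EGA4_Prop16_8_8_holds`, `EGA4_16_8_3_1_holds`

Both named facts above are PROVED here, following the printed proof of Prop. (16.8.8) (p.43: (a)⇔(c) through
«D' doit être nul dans ℑ^{n+1}(B ⊗_A M)» with ℑ generated by the `1 ⊗ a − a ⊗ 1` ((0, 20.4.4) there;
Mathlib `KaehlerDifferential.span_range_eq_ideal` here), (c)⇔(b) by «récurrence sur n») and the remark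
behind (16.8.3.1) («l'image de ℱ par dⁿ engendre 𝒫ⁿ(ℱ)»). Users' hypotheses `(h : EGA4_Prop16_8_8)` /
`(h : EGA4_16_8_3_1)` are fed `EGA4_Prop16_8_8_holds` / `EGA4_16_8_3_1_holds`. The statements above are
unchanged. -/

namespace EGA4_16_8

variable {R : Type u} [CommRing R] {A : Type v} [CommRing A] [Algebra R A]

/-! ### The left-`A`-linear extension `D' : a ⊗ b ↦ a · D b` of an `R`-linear `D : A → A`
(EGA IV₄ (16.8.2): «Soit alors D' le B-homomorphisme de B ⊗_A M dans N tel que D'(b ⊗ t) = bD(t)»);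
written inline as `lmul'' ∘ (D.baseChange A)` (Mathlib), no new definition. -/

/-- «D'(b ⊗ t) = bD(t)». [cite: EGAIV4, (16.8.2) p.40] -/
theorem extL_tmul (D : A →ₗ[R] A) (a b : A) :
    ((Algebra.TensorProduct.lmul'' R (S := A)).toLinearMap ∘ₗ D.baseChange A) (a ⊗ₜ[R] b) = a * D b := by
  show Algebra.TensorProduct.lmul'' R ((D.baseChange A) (a ⊗ₜ[R] b)) = a * D b
  rw [LinearMap.baseChange_tmul]
  rfl

/-- `D'` of a commutator: `[D, a]' x = D' (x · (1 ⊗ a − a ⊗ 1))`.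
[cite: EGAIV4, Prop. 16.8.8 (proof, p.43)] -/
theorem extL_commMul (D : A →ₗ[R] A) (a : A) (x : A ⊗[R] A) :
    ((Algebra.TensorProduct.lmul'' R (S := A)).toLinearMap ∘ₗ (commMul R D a).baseChange A) x =
      ((Algebra.TensorProduct.lmul'' R (S := A)).toLinearMap ∘ₗ D.baseChange A)
        (x * ((1 : A) ⊗ₜ[R] a - a ⊗ₜ[R] (1 : A))) := by
  induction x using TensorProduct.induction_on with
  | zero => simp
  | tmul b c =>
      rw [mul_sub, Algebra.TensorProduct.tmul_mul_tmul, Algebra.TensorProduct.tmul_mul_tmul, mul_one,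
        mul_one, mul_comm c a, map_sub, extL_tmul, extL_tmul, extL_tmul, commMul_apply]
      ring
  | add x y hx hy => rw [map_add, hx, hy, add_mul, map_add]

/-- `D'(1 ⊗ t) = D t`. [folklore] -/
private theorem extL_one_tmul (D : A →ₗ[R] A) (t : A) :
    ((Algebra.TensorProduct.lmul'' R (S := A)).toLinearMap ∘ₗ D.baseChange A) ((1 : A) ⊗ₜ[R] t) = D t := by
  rw [extL_tmul, one_mul]

/-! ### «`D'` vanishes on `ℑ^m`» -/

/-- `ℑ^0 = ⊤`: `D'` vanishes everywhere iff `D = 0`. [folklore] -/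
private theorem kills_zero_iff (D : A →ₗ[R] A) :
    (∀ x ∈ KaehlerDifferential.ideal R A ^ 0,
        ((Algebra.TensorProduct.lmul'' R (S := A)).toLinearMap ∘ₗ D.baseChange A) x = 0) ↔
      D = 0 := by
  constructor
  · intro h
    ext t
    rw [LinearMap.zero_apply, ← extL_one_tmul D t]
    exact h _ (by rw [pow_zero, Ideal.one_eq_top]; exact Submodule.mem_top)
  · rintro rfl x _
    simp

/-- The inductive step of EGA IV₄ 16.8.8 (b)⇔(c) at ring level: `D'` kills `ℑ^{m+1}` iff every
`[D, a]'` kills `ℑ^m`. [cite: EGAIV4, Prop. 16.8.8 (proof, p.43)] -/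
theorem kills_succ_iff (m : ℕ) (D : A →ₗ[R] A) :
    (∀ x ∈ KaehlerDifferential.ideal R A ^ (m + 1),
        ((Algebra.TensorProduct.lmul'' R (S := A)).toLinearMap ∘ₗ D.baseChange A) x = 0) ↔
      ∀ a : A, ∀ x ∈ KaehlerDifferential.ideal R A ^ m,
        ((Algebra.TensorProduct.lmul'' R (S := A)).toLinearMap ∘ₗ (commMul R D a).baseChange A) x
          = 0 := by
  constructor
  · intro h a x hx
    rw [extL_commMul]
    refine h _ ?_
    rw [pow_succ]
    exact Ideal.mul_mem_mul hx (KaehlerDifferential.one_smul_sub_smul_one_mem_ideal R a)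
  · intro h x hx
    rw [pow_succ] at hx
    refine Submodule.mul_induction_on hx (fun y hy z hz => ?_) (fun x₁ x₂ h₁ h₂ => ?_)
    · -- `z ∈ ℑ = span {1 ⊗ a − a ⊗ 1}`: reduce to generators, uniformly in `y ∈ ℑ^m`
      revert y
      rw [← KaehlerDifferential.span_range_eq_ideal] at hz
      refine Submodule.span_induction (p := fun z _ => ∀ y ∈ KaehlerDifferential.ideal R A ^ m,
        ((Algebra.TensorProduct.lmul'' R (S := A)).toLinearMap ∘ₗ D.baseChange A) (y * z) = 0) ?_ ?_ ?_ ?_ hz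
      · rintro _ ⟨a, rfl⟩ y hy
        rw [← extL_commMul]
        exact h a y hy
      · intro y _; rw [mul_zero, map_zero]
      · intro z₁ z₂ _ _ h₁ h₂ y hy
        rw [mul_add, map_add, h₁ y hy, h₂ y hy, add_zero]
      · intro w z _ hz' y hy
        rw [smul_eq_mul, ← mul_assoc]
        exact hz' (y * w) (Ideal.mul_mem_right w _ hy)
    · rw [map_add, h₁, h₂, add_zero]

/-- **EGA IV₄ 16.8.8 (b) ⇔ «`D'` kills `ℑ^{n+1}`»** (the ring-level content of (a)⇔(c)⇔(b)):
`IsDiffOpLE R n D` iff `D'` kills `ℑ^{n+1}`. [cite: EGAIV4, Prop. 16.8.8 (proof, p.43)] -/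
theorem isDiffOpLE_iff_kills :
    ∀ (n : ℕ) (D : A →ₗ[R] A),
      IsDiffOpLE R n D ↔
        ∀ x ∈ KaehlerDifferential.ideal R A ^ (n + 1),
          ((Algebra.TensorProduct.lmul'' R (S := A)).toLinearMap ∘ₗ D.baseChange A) x = 0
  | 0, D => by
    rw [isDiffOpLE_zero_iff, kills_succ_iff]
    exact forall_congr' fun a => (kills_zero_iff _).symm
  | n + 1, D => by
    rw [isDiffOpLE_succ_iff, kills_succ_iff]
    exact forall_congr' fun a => isDiffOpLE_iff_kills n _

/-! ### Principal parts: `cls(a ⊗ b) = a • dⁿ b` -/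

/-- `dⁿ(b) = cls(1 ⊗ b)` («la première flèche est l'homomorphisme canonique t ↦ 1 ⊗ t»).
[cite: EGAIV4, (16.8.2) p.40] -/
theorem principalPartsD_apply (n : ℕ) (b : A) :
    principalPartsD R A n b =
      Ideal.Quotient.mk (KaehlerDifferential.ideal R A ^ (n + 1)) ((1 : A) ⊗ₜ[R] b) := rfl

/-- `cls(a ⊗ b) = a • dⁿ(b)` in `P^n` (left structure): «l'image de ℱ par dⁿ engendre 𝒫ⁿ(ℱ)»
(16.7.6). [cite: EGAIV4, (16.8.3.1) p.41] -/
theorem mk_tmul (n : ℕ) (a b : A) :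
    Ideal.Quotient.mk (KaehlerDifferential.ideal R A ^ (n + 1)) (a ⊗ₜ[R] b) =
      a • principalPartsD R A n b := by
  rw [principalPartsD_apply, Algebra.smul_def, ← Ideal.Quotient.mk_algebraMap,
    Algebra.TensorProduct.algebraMap_apply, Algebra.algebraMap_self, RingHom.id_apply, ← map_mul,
    Algebra.TensorProduct.tmul_mul_tmul, mul_one, one_mul]

/-- `(u ∘ dⁿ)(b) = u(dⁿ b)` (Déf. 16.8.1: «D = u ∘ dⁿ»). [cite: EGAIV4, Déf. 16.8.1 p.39] -/
theorem diffOpOfPrincipalParts_apply (n : ℕ) (u : principalPartsRing R A n →ₗ[A] A) (b : A) :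
    diffOpOfPrincipalParts R A n u b = u (principalPartsD R A n b) := rfl

/-- For `D = u ∘ dⁿ`: `D' = u ∘ cls`. [cite: EGAIV4, (16.8.2) p.40] -/
theorem extL_diffOpOfPrincipalParts (n : ℕ) (u : principalPartsRing R A n →ₗ[A] A) (x : A ⊗[R] A) :
    ((Algebra.TensorProduct.lmul'' R (S := A)).toLinearMap ∘ₗ
        (diffOpOfPrincipalParts R A n u).baseChange A) x =
      u (Ideal.Quotient.mk (KaehlerDifferential.ideal R A ^ (n + 1)) x) := by
  induction x using TensorProduct.induction_on with
  | zero => simp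
  | tmul a b => rw [extL_tmul, diffOpOfPrincipalParts_apply, mk_tmul, map_smul, smul_eq_mul]
  | add x y hx hy => rw [map_add, hx, hy, map_add, map_add]

/-! ### (a) ⇔ «`D'` kills `ℑ^{n+1}`» -/

/-- EGA IV₄ (16.8.2): «la condition de factorisation sur D s'exprime encore en disant que D' doit être
nul dans [ℑ^{n+1}(B ⊗_A M)]». [cite: EGAIV4, (16.8.2) p.40] -/
theorem isDiffOpPP_iff_kills (n : ℕ) (D : A →ₗ[R] A) :
    IsDiffOpPP R A n D ↔
      ∀ x ∈ KaehlerDifferential.ideal R A ^ (n + 1),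
        ((Algebra.TensorProduct.lmul'' R (S := A)).toLinearMap ∘ₗ D.baseChange A) x = 0 := by
  constructor
  · rintro ⟨u, rfl⟩ x hx
    rw [extL_diffOpOfPrincipalParts, Ideal.Quotient.eq_zero_iff_mem.mpr hx, map_zero]
  · intro h
    -- factor `D'` through the quotient by `ℑ^{n+1}` (as an `A`-submodule)
    let J : Ideal (A ⊗[R] A) := KaehlerDifferential.ideal R A ^ (n + 1)
    have hJ : J.restrictScalars A ≤
        LinearMap.ker ((Algebra.TensorProduct.lmul'' R (S := A)).toLinearMap ∘ₗ D.baseChange A) :=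
      fun x hx => h x hx
    refine ⟨(J.restrictScalars A).liftQ _ hJ ∘ₗ
      (Submodule.Quotient.restrictScalarsEquiv A J).symm.toLinearMap, ?_⟩
    ext t
    rw [diffOpOfPrincipalParts_apply, principalPartsD_apply]
    change D t = (J.restrictScalars A).liftQ _ hJ
      ((Submodule.Quotient.restrictScalarsEquiv A J).symm (Submodule.Quotient.mk ((1 : A) ⊗ₜ[R] t)))
    rw [Submodule.Quotient.restrictScalarsEquiv_symm_mk, Submodule.liftQ_apply, extL_one_tmul]

end EGA4_16_8

/-- **EGA IV₄ Prop. 16.8.8 (a)⇔(b) holds** (ring level, `ℱ = 𝒢 = 𝒪_X`): Grothendieck's definition through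
principal parts agrees with the commutator recursion. Proof as printed (p.43): both sides are equivalent
to «`D' : a ⊗ b ↦ a·D b` vanishes on `ℑ^{n+1}`» — (a)⇔ by the universal property of the quotient
`P^n = (A ⊗ A)/ℑ^{n+1}`, (b)⇔ by induction on `n` using `[D,a]' (x) = D'(x·(1 ⊗ a − a ⊗ 1))` and
`ℑ = ⟨1 ⊗ a − a ⊗ 1⟩`. Discharges the named fact `EGA4_Prop16_8_8` (res-hironaka FACT-LIST F-12).
[cite: EGAIV4, Prop. 16.8.8 p.42–43] -/
theorem EGA4_Prop16_8_8_holds : EGA4_Prop16_8_8.{u, v} := by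
  intro R A _ _ _ n D
  exact (EGA4_16_8.isDiffOpPP_iff_kills n D).trans (EGA4_16_8.isDiffOpLE_iff_kills n D).symm

/-- **EGA IV₄ (16.8.3.1), injectivity, holds** (ring level, `ℱ = 𝒢 = 𝒪_X`): `u ↦ u ∘ dⁿ` is injective,
because the classes `dⁿ(b) = cls(1 ⊗ b)` generate `P^n` as a left `A`-module (`cls(a ⊗ b) = a • dⁿ b`,
16.7.6). Discharges the named fact `EGA4_16_8_3_1`. [cite: EGAIV4, (16.8.3.1) p.41] -/
theorem EGA4_16_8_3_1_holds : EGA4_16_8_3_1.{u, v} := by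
  intro R A _ _ _ n u₁ u₂ h
  apply LinearMap.ext
  intro q
  obtain ⟨x, rfl⟩ := Ideal.Quotient.mk_surjective q
  induction x using TensorProduct.induction_on with
  | zero => rw [map_zero, map_zero, map_zero]
  | tmul a b =>
      have hb : u₁ (principalPartsD R A n b) = u₂ (principalPartsD R A n b) := by
        rw [← EGA4_16_8.diffOpOfPrincipalParts_apply, ← EGA4_16_8.diffOpOfPrincipalParts_apply, h]
      rw [EGA4_16_8.mk_tmul, map_smul, map_smul, hb]
  | add x y hx hy => rw [map_add, map_add, map_add, hx, hy]


end Literature.AlgebraicGeometry.Resolution
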